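import Literature.AnabelianGeometry.EtaleTheta.TemperedFrobenioidGenuineWeakPiNatQ
import Literature.AnabelianGeometry.EtaleTheta.Discharge.Sec3Cor38iiiOfRlfQWeak
import Literature.AnabelianGeometry.EtaleTheta.Discharge.Sec3Cor38WeakPiNatInstance
import HarnessLib

/-!
# [EtTh] Corollary 3.8 (i), (ii), (iii) AS TYPED, monoid type `Λ = ℚ`, hold SIMULTANEOUSLY with no binder at the
# weak-vocabulary tempered Frobenioid of monoid type `ℚ` with INFINITELY many special-fibre components

S. Mochizuki, *The étale theta function and its Frobenioid-theoretic manifestations*, Publ. RIMS **45** (2009),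
Cor. 3.8 (i)–(iii), statement PDF p. 80, proof pp. 81–82 [cite: MochizukiEtTh2009, Cor 3.8 p.80]; Def. 3.3 (iii)
p. 73, Rmk. 3.3.1 p. 73, Prop. 3.4 (i)/(ii) p. 74, Def. 3.6 (i)/(ii) pp. 76–77 ("`B₀^ℚ := B₀^pf`, `F₀^ℚ := F₀^pf`"),
Rmk. 3.6.3 p. 79; S. Mochizuki, *The geometry of Frobenioids I* (2008), §0 p. 10, Def. 2.4 (i) pp. 47–48, Thm. 5.2
(ii) p. 100 [cite: MochizukiFrdI2008, Thm. 5.2(ii) p.100].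

abc-iut cell, layer L2, cone nodes `EtTh:Cor3.8(i)` / `(ii)` / `(iii)`, row «(H)-ℚ + COR38-NV@WeakPiNatQ», seat
abc-iut-L2-d2 (gen 5).  PROOF-ONLY (0 definitions) — the monoid-type-`ℚ` companion of this seat's
`Discharge/Sec3Cor38WeakPiNatInstance.lean` (p445706, `Λ = ℤ`) and `Discharge/Sec3Cor38WeakPiNatInstanceR.lean`
(p446212, `Λ = ℝ`), for the witness `C := WeakPiNat.genuineTemperedFrobenioidQ R S`
(`TemperedFrobenioidGenuineWeakPiNatQ.lean`: Def. 3.6 (ii) of monoid type `ℚ` over abc-iut-L6-t12's `ofRlfQWeak` at the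
Def. 3.3 (iii) datum `Φ₀ = ∏_ℕ ℤ_{≥0}`, `B₀ = F₀ = ϖ^ℤ`, `Φ := im(Φ₀^pf → Φ₀^rlf)`; cell finding F-L2d2-1: at such data
the printed-vocabulary interface is EMPTY).

THE CLOSERS: abc-iut-w6-d039's `Cor38Hyp.cor38_i_ofRlfQWeak_of_structural` (p439836), abc-iut-L1-t12's
`Cor38Hyp.cor38_ii_ofRlfQWeak_of_structural` / `hull_selfEquivalence_ofRlfQWeak`, and this seat's (H)-`ℚ` apex
`cor38_iii_ofRlfQWeak_of_isFrobenioid_of_countable_of_prop34Const` (`Sec3Cor38iiiOfRlfQWeak.lean`) — input lists per side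
`hB₀inj` · `hFSM` · `dm.Prop34` · `dm.Prop34Const` · [`hF₀inv`] · `hZQ` · `hsat`, resp. `IsFrobenioid` · `hcnt` ·
`Prop34Const`; EVERY ONE a theorem at the witness (this seat's p445706 / p442078: `hB₀inj_divisorMonoids`,
`prop34_divisorMonoids`, `prop34Const_divisorMonoids`, `isZQMonoprime_primes_Φ₀`, `countable_primes_perfection_Φ`;
abc-iut-w6-d040's `Toy.hFSM_discretePUnit` / `Toy.isDivSlim45iv_discretePUnit`; here `isFrobenioid_genuineTemperedFrobenioidQ`,
`ratSupport_genuineTemperedFrobenioidQ`):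

* §1 `isFrobenioid_genuineTemperedFrobenioidQ` ([FrdI] Thm. 5.2 (ii)), `countable_primes_perfection_ΦQ`,
  `genuineTemperedFrobenioidQ_nonDilating`, `nonempty_cor38HypQ` (`Ψ := 𝟭`), `ratSupport_genuineTemperedFrobenioidQ`;
* §2 **`cor38_i_genuineTemperedFrobenioidQ (h) : Cor38_i IsFrobeniusSlim h`**, `preservesBaseFieldTheoretic_…Q`,
  **`cor38_ii_genuineTemperedFrobenioidQ (h) : Cor38_ii (Def. 4.5 (iv)) h`**, `cor38_ii_conclusion_…Q`,
  `hull_selfEquivalence_…Q`, **`cor38_iii_genuineTemperedFrobenioidQ (h) : Cor38_iii h`**;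
* §3 **`cor38_genuineTemperedFrobenioidQ (h) : Cor38_i … h ∧ Cor38_ii … h ∧ Cor38_iii h`**, its conclusion form and
  `exists_…` — with p445706 (`ℤ`) and p446212 (`ℝ`): **the matrix {`ℤ`, `ℚ`, `ℝ`} × {(i), (ii), (iii)} of [EtTh] Cor. 3.8
  AS TYPED is INHABITED, with no binder beyond `h`, at tempered Frobenioids with infinitely many special-fibre
  components** (the F-L2d2-1 regime the cell's weak §3 chain was built for).

HONEST LABEL: a consistency / instantiation certificate at DEGENERATE geometry (one object, no cusps, constant functions
only) over GENUINE vocabularies — NOT the tempered Frobenioid of a curve; refereed pre-IUT material; nothing here bears on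
[IUTchIII] Cor. 3.12; no side taken; typed ≠ proved.
-/

noncomputable section

namespace Literature.AnabelianGeometry.EtaleTheta

open CategoryTheory Opposite Function Literature.AlgebraicGeometry.Frobenioids

namespace WeakPiNat

variable (R S : ((Discrete PUnit.{1})ᵒᵖ ⥤ CommMonCat.{0}) → Prop)

/-! ## §1 The `ℚ`-witness is a Frobenioid; countability, non-dilation, `Cor38Hyp`, rational support -/

/-- **The `Λ = ℚ` weak-vocabulary witness is a Frobenioid** ([FrdI] Thm. 5.2 (ii), `ModelFrobenioid.isFrobenioid`:
`Φ`, `B = B₀^ℚ|_D ×_{(Φ^{ℝ-log})^gp} Φ^gp` monoids on the one-object base, `Φ` divisorial, `B` group-like, `D` connected and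
totally epimorphic). [cite: MochizukiFrdI2008, Thm. 5.2(ii) p.100] -/
theorem isFrobenioid_genuineTemperedFrobenioidQ :
    PreFrobenioid.IsFrobenioid (WeakPiNat.genuineTemperedFrobenioidQ R S).toElem :=
  ModelFrobenioid.isFrobenioid
    (Cor38Toy.isMonoidOn_of_punit _)
    (fun A => PfImageWeak.isDivisorial_mrange_toRealification (isPerfFactorialCof_Φ₀ (op A)))
    (Cor38Toy.isMonoidOn_of_punit _)
    ((WeakPiNat.genuineTemperedFrobenioidQ R S).isGroupLike_ratFnFunctor WeakPiNat.realifiedQ.isUnit_BΛ)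
    (isGraphConnected_iff_isConnected.mpr (WeakPiNat.genuineTemperedFrobenioidQ R S).isConnected)
    (WeakPiNat.genuineTemperedFrobenioidQ R S).isTotallyEpimorphic

/-- The primes of `Φ(A)^pf` are countable at the `ℚ`-witness (same `Φ = ι(Φ₀^pf)` as at `Λ = ℤ`; G-L2d2-4 at the model).
[cite: MochizukiEtTh2009, Prop 3.2 p.70] -/
theorem countable_primes_perfection_ΦQ (A : (Discrete PUnit.{1})ᵒᵖ) :
    Countable (Primes (Perfection ↥((WeakPiNat.genuineTemperedFrobenioidQ R S).Φ.carrier A))) :=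
  countable_primes_perfection_Φ R S A

/-- `Φ` of the `ℚ`-witness is non-dilating under the endomorphisms of the base (identities).
[cite: MochizukiEtTh2009, Cor 3.8 p.80] -/
theorem genuineTemperedFrobenioidQ_nonDilating (A : (Discrete PUnit.{1})ᵒᵖ) (f : A ⟶ A) :
    treeMonoidVocabWeak.IsNonDilating _ ((WeakPiNat.genuineTemperedFrobenioidQ R S).Φ.pull f) := by
  have hf : f = 𝟙 A := Quiver.Hom.unop_inj (Subsingleton.elim _ _)
  subst hf
  rw [treeMonoidVocabWeak_isNonDilating]
  have hpull : (WeakPiNat.genuineTemperedFrobenioidQ R S).Φ.pull (𝟙 A) = MonoidHom.id _ := by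
    ext x
    rw [SubMonoidOn.coe_pull, CategoryTheory.Functor.map_id, MonoidHom.id_apply]
    rfl
  rw [hpull]
  exact Example39NV.isNonDilating_id

/-- **`Cor38Hyp` is inhabited at the `ℚ`-witness** (`Ψ := 𝟭`; `D` of FSM- hence FSMFF-type; `Φ` non-dilating).
[cite: MochizukiEtTh2009, Cor 3.8 p.80] -/
theorem nonempty_cor38HypQ :
    Nonempty (Cor38Hyp (WeakPiNat.genuineTemperedFrobenioidQ R S) (WeakPiNat.genuineTemperedFrobenioidQ R S)) :=
  ⟨{ Ψ := CategoryTheory.Equivalence.refl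
     fsmff := ⟨PadicFrd.isOfFSMType_discretePUnit.isOfFSMFFType, PadicFrd.isOfFSMType_discretePUnit.isOfFSMFFType⟩
     nonDilating := ⟨genuineTemperedFrobenioidQ_nonDilating R S, genuineTemperedFrobenioidQ_nonDilating R S⟩ }⟩

/-- **(hsat) at the `ℚ`-witness**: every `x ∈ Φ(W) = im(Φ₀^pf → Φ₀^rlf)` has a power in the image of `Φ₀(Y_W) → Φ₀^ℝ(Y_W)`.
[cite: MochizukiEtTh2009, Def 3.6 p.76] -/
theorem ratSupport_genuineTemperedFrobenioidQ (W : Discrete PUnit.{1}) :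
    ∀ x ∈ (WeakPiNat.genuineTemperedFrobenioidQ R S).Φ.carrier (op W),
      ∃ (N : ℕ+) (d : WeakPiNat.divisorMonoids.Φ₀.obj ((WeakPiNat.genuineTemperedFrobenioidQ R S).baseOp (op W))),
        x ^ (N : ℕ) =
          (isPerfFactorialCof_Φ₀ ((WeakPiNat.genuineTemperedFrobenioidQ R S).baseOp (op W))).weak.toRealification
            (Perfection.of _ d) := by
  rintro x ⟨a, rfl⟩
  obtain ⟨⟨c, n⟩, rfl⟩ := Perfection.mk_surjective a
  refine ⟨n, c, ?_⟩
  change (isPerfFactorialCof_Φ₀ _).weak.toRealification (Perfection.mk c n) ^ (n : ℕ) =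
    (isPerfFactorialCof_Φ₀ _).weak.toRealification (Perfection.of _ c)
  rw [← map_pow, Perfection.mk_pow_self]

/-! ## §2 Cor. 3.8 (i), (ii), (iii) AS TYPED at monoid type `ℚ`, and their conclusions -/

variable (R' S' : ((Discrete PUnit.{1})ᵒᵖ ⥤ CommMonCat.{0}) → Prop)

/-- **[EtTh] Cor. 3.8 (i) AS TYPED (vocabulary parameter := `IsFrobeniusSlim`) with NO hypothesis for EVERY Cor. 3.8 datum `h`
between two weak `ℚ`-witnesses at `Φ₀ = ∏_ℕ ℤ_{≥0}`** — abc-iut-w6-d039's `Cor38Hyp.cor38_i_ofRlfQWeak_of_structural` with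
its whole input list (`hB₀inj`, `hFSM`, `Prop34`, `Prop34Const`, `hZQ`, `hsat` per side) CHECKED at the witness.
[cite: MochizukiEtTh2009, Cor 3.8 p.80] -/
theorem cor38_i_genuineTemperedFrobenioidQ
    (h : Cor38Hyp (WeakPiNat.genuineTemperedFrobenioidQ R S) (WeakPiNat.genuineTemperedFrobenioidQ R' S')) :
    Literature.AnabelianGeometry.EtaleTheta.Cor38_i
      (fun E _ => Literature.AlgebraicGeometry.Frobenioids.IsFrobeniusSlim E) h :=
  h.cor38_i_ofRlfQWeak_of_structural (fun g => hB₀inj_divisorMonoids g) (fun α hα => Toy.hFSM_discretePUnit α hα)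
    (prop34_divisorMonoids R S) prop34Const_divisorMonoids (fun _ 𝔭 => isZQMonoprime_primes_Φ₀ _ 𝔭)
    (ratSupport_genuineTemperedFrobenioidQ R S) (fun g => hB₀inj_divisorMonoids g)
    (fun α hα => Toy.hFSM_discretePUnit α hα) (prop34_divisorMonoids R' S') prop34Const_divisorMonoids
    (fun _ 𝔭 => isZQMonoprime_primes_Φ₀ _ 𝔭) (ratSupport_genuineTemperedFrobenioidQ R' S')

/-- **The CONCLUSION of [EtTh] Cor. 3.8 (i) at the `ℚ`-witness, for every `h`** (the one-object base is slim, abc-iut-L1's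
`isSlim_discretePUnit`, hence Frobenius-slim). [cite: MochizukiEtTh2009, Cor 3.8 p.80] -/
theorem preservesBaseFieldTheoretic_genuineTemperedFrobenioidQ
    (h : Cor38Hyp (WeakPiNat.genuineTemperedFrobenioidQ R S) (WeakPiNat.genuineTemperedFrobenioidQ R' S')) :
    Literature.AnabelianGeometry.EtaleTheta.PreservesBaseFieldTheoretic h :=
  cor38_i_genuineTemperedFrobenioidQ R S R' S' h isSlim_discretePUnit.isFrobeniusSlim
    isSlim_discretePUnit.isFrobeniusSlim

/-- **[EtTh] Cor. 3.8 (ii) AS TYPED (vocabulary parameter := [FrdI] Def. 4.5 (iv) "Div-slim") with NO hypothesis for EVERY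
Cor. 3.8 datum `h` between two weak `ℚ`-witnesses at `Φ₀ = ∏_ℕ ℤ_{≥0}`** — abc-iut-L1-t12's
`Cor38Hyp.cor38_ii_ofRlfQWeak_of_structural` with its whole input list (`hB₀inj`, `hFSM`, `Prop34`, `Prop34Const`, `hF₀inv`,
`hZQ`, `hsat` per side) CHECKED at the witness. [cite: MochizukiEtTh2009, Cor 3.8 p.81] -/
theorem cor38_ii_genuineTemperedFrobenioidQ
    (h : Cor38Hyp (WeakPiNat.genuineTemperedFrobenioidQ R S) (WeakPiNat.genuineTemperedFrobenioidQ R' S')) :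
    Literature.AnabelianGeometry.EtaleTheta.Cor38_ii
      (fun E _ Φ => ∀ (A : E) (α : Aut (Over.forget A)),
        (∀ (B : Over A) (x : Φ.obj (op B.left)),
          Literature.AlgebraicGeometry.Frobenioids.pull Φ (α.hom.app B) x = x) → α = 1) h :=
  h.cor38_ii_ofRlfQWeak_of_structural (fun g => hB₀inj_divisorMonoids g) (fun α hα => Toy.hFSM_discretePUnit α hα)
    (prop34_divisorMonoids R S) prop34Const_divisorMonoids prop34Const_divisorMonoids.hF₀inv
    (fun _ 𝔭 => isZQMonoprime_primes_Φ₀ _ 𝔭) (ratSupport_genuineTemperedFrobenioidQ R S)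
    (fun g => hB₀inj_divisorMonoids g) (fun α hα => Toy.hFSM_discretePUnit α hα) (prop34_divisorMonoids R' S')
    prop34Const_divisorMonoids prop34Const_divisorMonoids.hF₀inv (fun _ 𝔭 => isZQMonoprime_primes_Φ₀ _ 𝔭)
    (ratSupport_genuineTemperedFrobenioidQ R' S')

/-- **The CONCLUSION of [EtTh] Cor. 3.8 (ii) at the `ℚ`-witness, for every `h`**: `Ψ` preserves the base-field-theoretic
morphisms and induces a compatible equivalence of the base-field-theoretic hulls (the base is Div-slim, abc-iut-w6-d040's
`Toy.isDivSlim45iv_discretePUnit`). [cite: MochizukiEtTh2009, Cor 3.8 p.81] -/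
theorem cor38_ii_conclusion_genuineTemperedFrobenioidQ
    (h : Cor38Hyp (WeakPiNat.genuineTemperedFrobenioidQ R S) (WeakPiNat.genuineTemperedFrobenioidQ R' S')) :
    PreservesBaseFieldTheoretic h ∧
      ∃ Ψbs : (WeakPiNat.genuineTemperedFrobenioidQ R S).hullCategory ≌
          (WeakPiNat.genuineTemperedFrobenioidQ R' S').hullCategory,
        Nonempty ((WeakPiNat.genuineTemperedFrobenioidQ R S).hull ⋙ h.Ψ.functor ≅
          Ψbs.functor ⋙ (WeakPiNat.genuineTemperedFrobenioidQ R' S').hull) :=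
  cor38_ii_genuineTemperedFrobenioidQ R S R' S' h (Toy.isDivSlim45iv_discretePUnit _)
    (Toy.isDivSlim45iv_discretePUnit _)

/-- **[EtTh] Cor. 3.8 (ii) for EVERY self-equivalence `e` of the `ℚ`-witness**: `e` preserves the base-field-theoretic
morphisms and lifts compatibly to a self-equivalence of the real hull category (abc-iut-L1-t12's
`hull_selfEquivalence_ofRlfQWeak`, every data-side clause CHECKED). [cite: MochizukiEtTh2009, Cor 3.8 p.81] -/
theorem hull_selfEquivalence_genuineTemperedFrobenioidQ
    (e : (WeakPiNat.genuineTemperedFrobenioidQ R S).category ≌ (WeakPiNat.genuineTemperedFrobenioidQ R S).category) :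
    (∀ {A B : (WeakPiNat.genuineTemperedFrobenioidQ R S).category} (f : A ⟶ B),
        (WeakPiNat.genuineTemperedFrobenioidQ R S).IsBaseFieldTheoretic f ↔
          (WeakPiNat.genuineTemperedFrobenioidQ R S).IsBaseFieldTheoretic (e.functor.map f)) ∧
      ∃ e' : (WeakPiNat.genuineTemperedFrobenioidQ R S).hullCategory ≌
          (WeakPiNat.genuineTemperedFrobenioidQ R S).hullCategory,
        Nonempty ((WeakPiNat.genuineTemperedFrobenioidQ R S).hull ⋙ e.functor ≅
          e'.functor ⋙ (WeakPiNat.genuineTemperedFrobenioidQ R S).hull) :=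
  TemperedFrobenioid.hull_selfEquivalence_ofRlfQWeak (WeakPiNat.genuineTemperedFrobenioidQ R S)
    PadicFrd.isOfFSMType_discretePUnit.isOfFSMFFType (genuineTemperedFrobenioidQ_nonDilating R S)
    (Toy.isDivSlim45iv_discretePUnit _) (isFrobenioid_genuineTemperedFrobenioidQ R S) (prop34_divisorMonoids R S)
    prop34Const_divisorMonoids.hF₀inv prop34Const_divisorMonoids.hcyc (fun _ 𝔭 => isZQMonoprime_primes_Φ₀ _ 𝔭)
    (ratSupport_genuineTemperedFrobenioidQ R S) e

/-- **[EtTh] Cor. 3.8 (iii), first clause, AS TYPED, monoid type `ℚ`, with NO hypothesis for EVERY Cor. 3.8 datum between two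
weak `ℚ`-witnesses at `Φ₀ = ∏_ℕ ℤ_{≥0}`** — this seat's (H)-`ℚ` apex
`cor38_iii_ofRlfQWeak_of_isFrobenioid_of_countable_of_prop34Const` with `IsFrobenioid`, `hcnt`, `Prop34Const` discharged
above / in the `Λ = ℤ` instance file. [cite: MochizukiEtTh2009, Cor 3.8 p.81] -/
theorem cor38_iii_genuineTemperedFrobenioidQ
    (h : Cor38Hyp (WeakPiNat.genuineTemperedFrobenioidQ R S) (WeakPiNat.genuineTemperedFrobenioidQ R' S')) :
    Cor38_iii h :=
  cor38_iii_ofRlfQWeak_of_isFrobenioid_of_countable_of_prop34Const h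
    (countable_primes_perfection_ΦQ R S) (countable_primes_perfection_ΦQ R' S')
    prop34Const_divisorMonoids prop34Const_divisorMonoids
    (isFrobenioid_genuineTemperedFrobenioidQ R S) (isFrobenioid_genuineTemperedFrobenioidQ R' S')

/-! ## §3 Cor. 3.8 (i) ∧ (ii) ∧ (iii) at monoid type `ℚ` — the `{ℤ, ℚ, ℝ} × {(i), (ii), (iii)}` matrix complete -/

/-- **[EtTh] Cor. 3.8 (i), (ii) AND (iii) AS TYPED hold SIMULTANEOUSLY, with NO hypothesis beyond `h`, for every Cor. 3.8
datum `h` between two weak `ℚ`-witnesses at `Φ₀ = ∏_ℕ ℤ_{≥0}`** — with p445706 (`ℤ`) and p446212 (`ℝ`), all three parts of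
[EtTh] Cor. 3.8 fire at ALL THREE monoid types over weak data with infinitely many special-fibre components.
[cite: MochizukiEtTh2009, Cor 3.8 p.80] -/
theorem cor38_genuineTemperedFrobenioidQ
    (h : Cor38Hyp (WeakPiNat.genuineTemperedFrobenioidQ R S) (WeakPiNat.genuineTemperedFrobenioidQ R' S')) :
    Literature.AnabelianGeometry.EtaleTheta.Cor38_i
        (fun E _ => Literature.AlgebraicGeometry.Frobenioids.IsFrobeniusSlim E) h ∧
      Literature.AnabelianGeometry.EtaleTheta.Cor38_ii
        (fun E _ Φ => ∀ (A : E) (α : Aut (Over.forget A)),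
          (∀ (B : Over A) (x : Φ.obj (op B.left)),
            Literature.AlgebraicGeometry.Frobenioids.pull Φ (α.hom.app B) x = x) → α = 1) h ∧
      Cor38_iii h :=
  ⟨cor38_i_genuineTemperedFrobenioidQ R S R' S' h, cor38_ii_genuineTemperedFrobenioidQ R S R' S' h,
    cor38_iii_genuineTemperedFrobenioidQ R S R' S' h⟩

/-- **The CONCLUSIONS of [EtTh] Cor. 3.8 (i), (ii), (iii) simultaneously at the `ℚ`-witness, for every `h`.**
[cite: MochizukiEtTh2009, Cor 3.8 p.80] -/
theorem cor38_conclusion_genuineTemperedFrobenioidQ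
    (h : Cor38Hyp (WeakPiNat.genuineTemperedFrobenioidQ R S) (WeakPiNat.genuineTemperedFrobenioidQ R' S')) :
    PreservesBaseFieldTheoretic h ∧
      (∃ Ψbs : (WeakPiNat.genuineTemperedFrobenioidQ R S).hullCategory ≌
          (WeakPiNat.genuineTemperedFrobenioidQ R' S').hullCategory,
        Nonempty ((WeakPiNat.genuineTemperedFrobenioidQ R S).hull ⋙ h.Ψ.functor ≅
          Ψbs.functor ⋙ (WeakPiNat.genuineTemperedFrobenioidQ R' S').hull)) ∧
      Cor38_iii h :=
  ⟨preservesBaseFieldTheoretic_genuineTemperedFrobenioidQ R S R' S' h,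
    (cor38_ii_conclusion_genuineTemperedFrobenioidQ R S R' S' h).2, cor38_iii_genuineTemperedFrobenioidQ R S R' S' h⟩

/-- **The typed statements of the nodes `EtTh:Cor3.8(i)`, `(ii)`, `(iii)` have a SIMULTANEOUS unconditional kernel instance
at monoid type `ℚ` and infinitely many special-fibre components** (inhabitant `nonempty_cor38HypQ`, `Ψ := 𝟭`).
[cite: MochizukiEtTh2009, Cor 3.8 p.80] -/
theorem exists_cor38Hyp_cor38_Q :
    ∃ h : Cor38Hyp (WeakPiNat.genuineTemperedFrobenioidQ R S) (WeakPiNat.genuineTemperedFrobenioidQ R S),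
      Literature.AnabelianGeometry.EtaleTheta.Cor38_i
          (fun E _ => Literature.AlgebraicGeometry.Frobenioids.IsFrobeniusSlim E) h ∧
        Literature.AnabelianGeometry.EtaleTheta.Cor38_ii
          (fun E _ Φ => ∀ (A : E) (α : Aut (Over.forget A)),
            (∀ (B : Over A) (x : Φ.obj (op B.left)),
              Literature.AlgebraicGeometry.Frobenioids.pull Φ (α.hom.app B) x = x) → α = 1) h ∧
        Cor38_iii h := by
  obtain ⟨h⟩ := nonempty_cor38HypQ R S
  exact ⟨h, cor38_genuineTemperedFrobenioidQ R S R S h⟩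

/-- … and so have their conclusions, at monoid type `ℚ`. [cite: MochizukiEtTh2009, Cor 3.8 p.80] -/
theorem exists_cor38Hyp_cor38_conclusion_Q :
    ∃ h : Cor38Hyp (WeakPiNat.genuineTemperedFrobenioidQ R S) (WeakPiNat.genuineTemperedFrobenioidQ R S),
      PreservesBaseFieldTheoretic h ∧
        (∃ Ψbs : (WeakPiNat.genuineTemperedFrobenioidQ R S).hullCategory ≌
            (WeakPiNat.genuineTemperedFrobenioidQ R S).hullCategory,
          Nonempty ((WeakPiNat.genuineTemperedFrobenioidQ R S).hull ⋙ h.Ψ.functor ≅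
            Ψbs.functor ⋙ (WeakPiNat.genuineTemperedFrobenioidQ R S).hull)) ∧
        Cor38_iii h := by
  obtain ⟨h⟩ := nonempty_cor38HypQ R S
  exact ⟨h, cor38_conclusion_genuineTemperedFrobenioidQ R S R S h⟩

end WeakPiNat

end Literature.AnabelianGeometry.EtaleTheta

end
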